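import Summits.BirchSwinnertonDyer.BirchSwinnertonDyer.Theorems.ByReductionTypeAtTwoOrdKatoHalfAtTwoIsoOptimalOff514Defs
import HarnessLib

/-!
# Route ByReductionTypeAtTwo, crux `OrdKatoHalfAtTwoIso` (stmt-BirchSwinnertonDyer-19573), line
# `steinberg-fibre-at-two`: the off-residue binder B7 SPLIT BY IMAGE — `E[2]` reducible vs `E[2]` irreducible with
# `ρ̄_{W,2}` not onto (image `C₃`) — and re-cut on the irreducible part (Theorems-side definitions + kernel doors)

Seat `cruxlead-stmt-BirchSwinnertonDyer-19573-g4` (LEAD PROVER, MODE LINE; HOME `run/shared/lean/pub/bsd-2adic/`;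
`--supports` stmt-BirchSwinnertonDyer-23780 `OrdKatoMuPartOptimalAtTwo`). HONEST FRAMING (cell bsd-2adic): BSD is not
proved by any of this; the crux `OrdKatoHalfAtTwoIso` is NOT proved here; the two definitions below are OPEN memo-tier
statements DISPLAYED BY NAME, nothing is asserted about them, and every door is CONDITIONAL on the binders it displays.

WHY THIS FILE. The re-cut B7 `KatoMuPartOff514AtOptimalMemberOfNotSurjectiveTwo` (p679274) still asks, on its whole
habitat «`ρ̄_{W,2}` not onto», for an isogenous member `W′` carrying (a′) the `μ`-part clause or a Prop-5.14 point and
(b) integral lifts of `ϖ·L₂(f, α)`. On the part of the habitat where `E[2]` is IRREDUCIBLE (image `C₃`; crux-triage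
census: 288 classes with `N < 5·10⁵`), clause (b) is PRINT at EVERY member — Abbes–Ullmo at the good prime `2` plus
odd-degree isogenies give `ord₂ ϖ = 0` and INT2-AUTO the lift (`hint_two_of_abbesUllmo_of_irr`, p654400) — and no
Prop-5.14 point exists (no rational `2`-torsion), so B7 there is exactly «`X5.O1.KatoMuPartAtTwo` at SOME isogenous
member», for which `W` itself may be taken. Hence B7 splits into:

* `KatoMuPartIrrNotSurjectiveTwo` — **[MEMO tier, OPEN] B7 on the `C₃` part, re-cut**: for every globally minimal
  `W`, good ordinary at `2`, `E[2]` irreducible, `ρ̄_{W,2}` not onto: `X5.O1.KatoMuPartAtTwo W` (at `W` itself; no lift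
  clause, no member choice). MEMO-7 Thm. D-C₃ (Weber / Ferrero–Washington for `ℚ(E[2], i)`); not in print.
* `KatoMuPartOff514ReducibleTwo` — **[MEMO tier, OPEN] B7 on the reducible part**: the re-cut B7 restricted to
  `E[2]` REDUCIBLE curves (verbatim body of `KatoMuPartOff514AtOptimalMemberOfNotSurjectiveTwo` under `¬ Irr`).
* `katoMuPartOff514_of_split` — KERNEL: the two parts + Abbes–Ullmo BY NAME ⇒ the re-cut B7 (on the irreducible part
  take `W′ := W`, left disjunct, lifts from `hint_two_of_abbesUllmo_of_irr`).
* `katoMuPartOff514Reducible_of_off514` — KERNEL: the re-cut B7 implies its reducible part (restriction; a surjective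
  `ρ̄₂` would be irreducible). The converse on the `C₃` part («B7 at some member ⇒ the `μ`-part at `W` itself») holds
  by isogeny transport of `μ(X)` and `ord₂ ϖ` on an `E[2]`-irreducible class (cell file `KatoHalfIsogeny`) and is not
  needed by the doors below, so it is not recorded here.
* `ordKatoHalfAtTwoIso_of_split` / `_cite` — **the crux BY NAME** from: re-cut socket 2 (p678187), Abbes–Ullmo,
  Prop. 5.14 at `2`, the two B7 parts, B8 on `Δ > 0` (resp. the filed B8 + PUB), Kato 17.4 (1)(2) at `2`.

References: [GreenbergLNM1716] Prop. 5.14, Conj. 1.11; [Kato2004Asterisque] Thm 17.4 (p. 273); [AbbesUllmo1996] Thm A;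
[SerreOpenImage1972] §5; MEMO-7 (HOME); TRIAGE-r1-2 gen 22 (crux dir).
-/

set_option autoImplicit false
set_option linter.dupNamespace false

noncomputable section

open scoped Classical MatrixGroups ModularForm NumberField
open CongruenceSubgroup WeierstrassCurve Field IsDedekindDomain
open Literature.NumberTheory.GaloisRepresentations
open Literature.NumberTheory.EllipticCurves Literature.NumberTheory.EllipticCurves.ModularForms
open Literature.NumberTheory.EllipticCurves.Kato2004
open Literature.NumberTheory.EllipticCurves.Rank1Residual
open Literature.NumberTheory.EllipticCurves.Greenberg1999
open Summit.BirchSwinnertonDyer.Rank1Residual Summit.BirchSwinnertonDyer.Rank1Residual.X5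
open Summit.BirchSwinnertonDyer.BirchSwinnertonDyer.Theorems.OrdKatoOptimalAtTwo
  Summit.BirchSwinnertonDyer.BirchSwinnertonDyer.Theorems.OrdKatoIntAtTwo
open Summit.BirchSwinnertonDyer.BirchSwinnertonDyer.Theses.ByReductionTypeAtTwo

namespace Summit.BirchSwinnertonDyer.BirchSwinnertonDyer.Theorems.SteinbergFibreAtTwo

/-! ## §1 The two parts of B7, displayed by name -/

/-- [MEMO tier, OPEN] **B7 on the `C₃` part, RE-CUT (lead g4)**: for every globally minimal `W`, good ordinary at
`2`, with `E[2]` irreducible and `ρ̄_{W,2}` NOT onto (image of order `3`), Kato's `μ`-part statement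
`X5.O1.KatoMuPartAtTwo W` holds at `W` itself. (B7 = MEMO-7 Thm. D restricted to this habitat, with the member choice
and the lift clause removed — both are print here.) NOT in print at `p = 2`; nothing asserted.
[cite: GreenbergLNM1716, Conj. 1.11 (shape only; nothing asserted)] -/
@[conjecture] def KatoMuPartIrrNotSurjectiveTwo : Prop :=
  ∀ (W : WeierstrassCurve ℚ) [W.IsElliptic] [W.IsGloballyMinimal],
    GoodOrd W 2 → W.HasIrreducibleModPGaloisRep 2 → ¬ W.HasSurjectiveModNGaloisRep 2 → O1.KatoMuPartAtTwo W

/-- [MEMO tier, OPEN] **B7 on the `E[2]`-REDUCIBLE part** (the re-cut B7 `KatoMuPartOff514AtOptimalMemberOfNotSurjectiveTwo`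
restricted to `¬ Irr(E[2])`): an isogenous globally minimal member with (the `μ`-part clause OR a Prop-5.14 point) and
integral lifts. MEMO-7 Thm. D (reducible case); NOT in print at `p = 2`; nothing asserted.
[cite: GreenbergLNM1716, Prop. 5.14 and p. 170 (shape only; nothing asserted)] [cite: Wuthrich2014, Thm. 16 (p odd; shape only)] -/
@[conjecture] def KatoMuPartOff514ReducibleTwo : Prop :=
  ∀ (W : WeierstrassCurve ℚ) [W.IsElliptic] [W.IsGloballyMinimal],
    ¬ W.HasCM → GoodOrd W 2 → ¬ W.HasIrreducibleModPGaloisRep 2 →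
    ∃ (W' : WeierstrassCurve ℚ) (_ : W'.IsElliptic) (_ : W'.IsGloballyMinimal),
      WeierstrassCurve.IsIsogenous W W' ∧
      (O1.KatoMuPartAtTwo W' ∨ ∃ x y : ℚ, W'.toAffine.Equation x y ∧ 2 * y + W'.a₁ * x + W'.a₃ = 0 ∧
        ((TwoTorsionRamifiedAtTwo x ∧ ¬ TwoTorsionOdd W' x) ∨
          (TwoTorsionOdd W' x ∧ ¬ TwoTorsionRamifiedAtTwo x))) ∧
      ∀ [NeZero (W'.conductorNorm ℤ)] (f : CuspForm (Gamma0 (W'.conductorNorm ℤ)) 2),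
        IsNewformOf W' f → ∀ ϖ : ℚ, (ϖ : ℝ) * W'.realPeriodRat = plusPeriod f →
          ∃ L₀ : IwasawaAlgebra 2, iwasawaToPowerSeries 2 L₀ =
            PowerSeries.C (ϖ : ℚ_[2]) * padicLFunction f (unitRoot W' 2 : ℚ_[2])

/-! ## §2 The parts assemble to the re-cut B7 (KERNEL modulo Abbes–Ullmo by name) -/

/-- **The two parts + Abbes–Ullmo BY NAME ⇒ the re-cut B7.** On an `E[2]`-irreducible curve take `W′ := W` (identity
isogeny), the `μ`-part from `KatoMuPartIrrNotSurjectiveTwo`, and the integral lifts from `hint_two_of_abbesUllmo_of_irr`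
(INT2-AUTO + `ord₂ ϖ = 0`, p654400); on a reducible curve the second part is verbatim. [cite: AbbesUllmo1996, Thm. A] -/
theorem katoMuPartOff514_of_split (hAU : abbesUllmo_not_dvd_maninConstant_of_not_dvd_level)
    (hIrr : KatoMuPartIrrNotSurjectiveTwo) (hRed : KatoMuPartOff514ReducibleTwo) :
    KatoMuPartOff514AtOptimalMemberOfNotSurjectiveTwo := by
  intro W _ _ hcm hgo him
  by_cases hirr : W.HasIrreducibleModPGaloisRep 2
  · exact ⟨W, ‹_›, ‹_›, isIsogenous_self W, Or.inl (hIrr W hgo hirr him),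
      fun f hf ϖ hϖ => hint_two_of_abbesUllmo_of_irr hAU W hgo hirr f hf ϖ hϖ⟩
  · exact hRed W hcm hgo hirr

/-- **The re-cut B7 implies its reducible part** (restriction). [folklore] -/
theorem katoMuPartOff514Reducible_of_off514 (hB7' : KatoMuPartOff514AtOptimalMemberOfNotSurjectiveTwo) :
    KatoMuPartOff514ReducibleTwo := by
  intro W _ _ hcm hgo hred
  haveI : NeZero ((2 : ℕ) : ℚ) := ⟨by norm_num⟩
  exact hB7' W hcm hgo fun hs => hred (hasIrreducibleModPGaloisRep_of_hasSurjectiveModNGaloisRep W 2 hs)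

/-! ## §3 The crux BY NAME from the split binder set -/

/-- **The crux `OrdKatoHalfAtTwoIso` (stmt-BirchSwinnertonDyer-19573) BY NAME from the SPLIT, fully re-cut binders**:
re-cut socket 2 `ZetaColemanMuInputsNegDiscAtTwo` (memo), Abbes–Ullmo (print), Greenberg's Prop. 5.14 at `2` (print),
B7 on the `C₃` part and on the reducible part (memo), B8 on `Δ > 0` only (memo), Kato 17.4 (1)(2) at `2` (print) — via
`ordKatoHalfAtTwoIso_of_recut` (p679274). Conditional; nothing closed.
[cite: Kato2004Asterisque, Thm. 17.4 (1)(2) (p. 273)] [cite: GreenbergLNM1716, Prop. 5.14] [cite: AbbesUllmo1996, Thm. A] -/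
theorem ordKatoHalfAtTwoIso_of_split (hF : ZetaColemanMuInputsNegDiscAtTwo)
    (hAU : abbesUllmo_not_dvd_maninConstant_of_not_dvd_level) (h514 : prop514_isTorsion_mu_eq_zero_two)
    (hIrr : KatoMuPartIrrNotSurjectiveTwo) (hRed : KatoMuPartOff514ReducibleTwo)
    (hB8pos : ∀ (W : WeierstrassCurve ℚ) [W.IsElliptic] [W.IsGloballyMinimal],
      GoodOrd W 2 → O1.TwoAdicSurjective W → 0 < W.Δ → O1.MainConjectureLowerDivisibilityAtTwoOrd W)
    (h17 : ∀ (V : WeierstrassCurve ℚ) [V.IsElliptic] [V.IsGloballyMinimal] [NeZero (V.conductorNorm ℤ)]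
      (f : CuspForm (Gamma0 (V.conductorNorm ℤ)) 2), kato_divisibility_allPrimes V 2 (f := f)) :
    OrdKatoHalfAtTwoIso :=
  ordKatoHalfAtTwoIso_of_recut hF hAU h514 (katoMuPartOff514_of_split hAU hIrr hRed) hB8pos h17

/-- **The crux BY NAME from the split binders, the FILED B8 and the route's PUB item.** Conditional; nothing closed.
[cite: Kato2004Asterisque, Thm. 17.4 (1)(2) (p. 273)] [cite: GreenbergLNM1716, Prop. 5.14] [cite: AbbesUllmo1996, Thm. A] -/
theorem ordKatoHalfAtTwoIso_of_split_cite (hF : ZetaColemanMuInputsNegDiscAtTwo)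
    (hAU : abbesUllmo_not_dvd_maninConstant_of_not_dvd_level) (h514 : prop514_isTorsion_mu_eq_zero_two)
    (hIrr : KatoMuPartIrrNotSurjectiveTwo) (hRed : KatoMuPartOff514ReducibleTwo)
    (hB8 : KatoIntAtGoodOrdSurjectiveTwo) (hPub : OrdPublishedInputsAtTwo) : OrdKatoHalfAtTwoIso := by
  obtain ⟨_, _, h17, _⟩ := hPub
  exact ordKatoHalfAtTwoIso_of_split hF hAU h514 hIrr hRed (katoIntPosDisc_of_katoInt hB8) h17

end Summit.BirchSwinnertonDyer.BirchSwinnertonDyer.Theorems.SteinbergFibreAtTwo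

end
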